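import Literature.NumberTheory.Automorphic.UnitaryRankTwoDepthExpansionRamified             -- ★-to-be A-p13 (g32) (R5b-α) FILE α2: the generic ramified EDGE head
import Literature.NumberTheory.Automorphic.SelfDualStableLatticeDepthCountRamifiedFrames   -- ★ p843724 A-p01 (g21) R2-D: `finite_and_ncard_selfDualStable_of_diagonal_frame`, ramified package
import Literature.NumberTheory.Automorphic.UnitaryGroupSelfDualLocusRamifiedPlace          -- ★ A-p06∕B-p04 lineage: `exists_mem_unitaryGroupOfForm_mul_of_selfDual_of_ramified` (ramified docking)
import Literature.NumberTheory.Rogawski1990.RankOneKappaOrbitalDepthExpansionH             -- ★ p843595 A-p13 (g32) S0+S1 (inert twin): `coe_localNonsplitEquiv_mul_map_eq`, ★ I-7, ★ asm, torus frame lemmas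
import HarnessLib

/-!
# (R5b-α) FILE α4 — THE PER-PIECE SIGNED DEPTH EXPANSION of a localised orbital integral on `H_v = U(Φ₂)(L⁺_v) × U(Φ₁)(L⁺_v)` at a TAMELY RAMIFIED place,
# EDGE piece (`K ↔ U ∩ GL₂(𝒪_w)` through the one-place model): the CM dress of ★ α2 + the `H_v` reading ★ I-7 (road «R1-ram», architect A-p16 (g27) RULINGS A-19, A-22;
designer B-p12 (g29) memo 06d3de01; END-brick assembler F0P3a-p03 (g12); typist A-p13 (g32))

Topic `NumberTheory/Rogawski1990`; namespace `Literature.NumberTheory.Rogawski1990`.  THEOREMS ONLY (no definition, no instance, no notation, no named fact, no `sorry`);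
kernel lane `--supports stmt-HodgeConjecture-24833`.  Cell `pub/hodgecm-mathlib` (D-0151), crux H413, residue `RankOneUnstableTransferNonsplitCMERamified` of #159.
HONEST LABEL: HC_CM is proved only modulo the 2 remaining named inputs (hLiu418, h413) until rung 0 closes; this file is bookkeeping between ★ theorems.

THE MATHEMATICS (Labesse–Langlands 1979 §2; Rogawski 1990 §4.9; Kottwitz 1988 §2).  `v` non-split, TAMELY RAMIFIED in the CM field `L` (`e(w|v) ≠ 1`, `|2|_w = 1`), `w ∣ v`,
`ϖ` an ANTI-FIXED uniformiser of `L_w` (`σ_w ϖ = −ϖ`, ★ p843426), `(σO, hres)` the integral involution package (★ `exists_integer_involution_of_ramified` ∕ ★ R-0c), `η ∈ 𝒪_wˣ`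
σ-fixed of non-square residue; `E₂ : U(Φ₂)(L⁺_v) ≃ₜ* U := U(σ_w, (Φ₂)_w)(L_w)` a one-place model, `K ≤ U(Φ₂)(L⁺_v)` with `g ∈ K ↔ E₂ g ∈ U ∩ GL₂(𝒪_w)`.  For `x ∈ H_v` with a
NORMALISED one-place frame — `(E₂ x.1)·Q = Q·diag(u)` (`u₀ ≠ u₁` of norm one, `|u₀ − u₁|_w = |ϖ^N|`) and `ᵗσ_w(Q)(Φ₂)_w Q = diag(h)` with σ-fixed UNITS `hᵢ`, `h₀ r = −h₁`,
`r̄` a square (★ A-p01 `exists_diagonal_unit_frame_antidiagTwo_of_ramified` supplies `(Q, h, r)`; at the similitude partner `e t` use `D_{u₀}Q` and `u₀ • h`) — and a piece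
`φ : H_v → E` supported in `K × U(Φ₁)_v`, `Ad`-invariant under it, right-`Km`-invariant at the one place (`Km ≤ U` DATA with the `ϖ`-level-`m` law — ★ A-p16
`exists_level_data_onePlace_of_v_eq`), `{y | y x y⁻¹ ∈ K × U(Φ₁)_v}` compact:
**`integral_conj_eq_smul_signedDepthExpansion_onePlace_ramified`** — there are bits `e i ≤ 1`, characterised for odd `i < m` by `e i = 0 ⟺ (−1)^{(N+i)∕2+1}u₁((u₀−u₁)ϖ^{−N})h₀`
has square residue, the scalar point `xm = u₁·1` and window points `xs i = u₁(1 + ϖ^i[[0,η^{e i}],[0,0]])` (odd `i`) in `U`, with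
`∫ φ(y x y⁻¹) dν = ν(K × U(Φ₁)_v) • ((Σ_{j ≤ N, j even, j+m ≤ N} m(j)) • φ(E₂⁻¹ xm, x.2) + Σ_{i<m} [i ≤ N ∧ N − i even]·m(N−i) • φ(E₂⁻¹ (xs i), x.2))`, `m(0) = 1`, `m(j) = 2q_v^{j∕2}`
= ★ I-7 `integral_conj_eq_smul_finsum_onePlace_of_isCompact` ∘ ★ α2 `finsum_fixedBy_conj_eq_signedDepthExpansion_ramified`, with the generic hypotheses of α2 DISCHARGED at
`w`: `hdock` (★ `exists_mem_unitaryGroupOfForm_mul_of_selfDual_of_ramified`), `hfin` (★ R2-D `finite_and_ncard_selfDualStable_of_diagonal_frame` + ★ L2a injectivity),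
`hq = q_v` and the DVR ∕ `2 ∈ 𝒪ˣ` facts (★ `exists_integer_involution_of_ramified`, ★ `isDiscreteValuationRing_integer_of_compatible`).
**`frame_onePlace_of_mem_centralizer_of_v_eq`** — ★ S0 with the depth read against ANY uniformiser `ϖ` of `L_w` (`|ϖ| = exp(−1)`; no `hunr`): for `t ∈ Z(t₀)` regular,
`(E₂ t.1)·P_w = P_w·diag(u)`, `u₀ ≠ u₁`, `σ_w(uᵢ)uᵢ = 1`, `|u₀ − u₁|_w = |ϖ|^{N t}`, `N t := (−log v_w((τ₀ t − τ₁ t)_w)).toNat`.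

## References
* [LabesseLanglands1979] J.-P. Labesse, R. P. Langlands, *L-indistinguishability for SL(2)*, Canad. J. Math. 31 (1979): §2 Lemma 2.1 pp. 8–9.
* [Rogawski1990] J. D. Rogawski, *Automorphic Representations of Unitary Groups in Three Variables*, Ann. of Math. Stud. 123 (1990): §4.9 pp. 54–56, Lemma 4.9.3.
* [Kottwitz1988] R. E. Kottwitz, *Tamagawa numbers*, Ann. of Math. 127 (1988): §2.
-/

set_option autoImplicit false

noncomputable section

open MeasureTheory Topology Set Function MulAction NumberField IsDedekindDomain Matrix Finset ValuativeRel
open scoped MatrixGroups ValuativeRel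

namespace Literature.NumberTheory.Rogawski1990

open Literature.NumberTheory.Automorphic Literature.NumberTheory.Automorphic.UnitaryGroup Literature.NumberTheory.GaloisRepresentations

/-! ## §1 (S0-ram) The frame of `E₂ (↑t).1` at the one place, depth against any uniformiser -/

section Frame

variable (L : Type) [Field L] [NumberField L] [IsCMField L] (v : HeightOneSpectrum (𝓞 ↥(maximalRealSubfield L)))
  (w : PlacesOver L v) (hw : IsCMField.complexConj L • w.1 = w.1)

/-- `![a, b]` is injective when `a ≠ b`. [folklore] -/
private theorem injective_vecCons_two_S0r {X : Type*} {a b : X} (h : a ≠ b) : Function.Injective ![a, b] := by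
  intro i j hij
  fin_cases i <;> fin_cases j
  · rfl
  · exact absurd hij h
  · exact absurd hij.symm h
  · rfl

variable (t₀ : ((cmDatum L 2 (Matrix.of fun i j : Fin 2 => if i.val + j.val + 1 = 2 then (1 : L) else 0)).Local v × (cmDatum L 1 (Matrix.of fun i j : Fin 1 => if i.val + j.val + 1 = 1 then (1 : L) else 0)).Local v)) (P : GL (Fin 2) (LocalRing L v)) (d : Fin 2 → LocalRing L v) (ht₀ : IsRegularElt (t₀.1.val : GL (Fin 2) (LocalRing L v)))
  (hP : (t₀.1.val.val : Matrix (Fin 2) (Fin 2) (LocalRing L v)) * P.val = P.val * Matrix.diagonal d) (hd1 : ∀ i, conjLocal L (IsCMField.complexConj L) v (d i) * d i = 1)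

include hw ht₀ hP hd1 in
/-- **S0-ram — THE FRAME AT ONE PLACE, depth against ANY uniformiser** (no `hunr`: valid at ramified `w` with `ϖ` the anti-fixed uniformiser).  For `t ∈ Z(t₀)` regular and a
one-place model `E₂` agreeing with ★ `localNonsplitEquiv` on matrices: `(E₂ t.1)·P_w = P_w·diag(u)`, `u₀ ≠ u₁`, `σ_w(uᵢ) uᵢ = 1`, `v_w(u₀ − u₁) = v_w(ϖ)^{N t}`,
`u = ((τ₀ t)_w, (τ₁ t)_w)`, `N t := (−log v_w((τ₀ t − τ₁ t)_w)).toNat`. [cite: Rogawski1990, §3.6 pp. 31–32; §4.9 p. 55] -/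
theorem frame_onePlace_of_mem_centralizer_of_v_eq (ϖ : w.1.adicCompletion L) (hϖ : Valued.v ϖ = WithZero.exp (-1 : ℤ))
    (E₂ : (cmDatum L 2 (Matrix.of fun i j : Fin 2 => if i.val + j.val + 1 = 2 then (1 : L) else 0)).Local v ≃ₜ* ↥(unitaryGroupOfForm (galAdicCompletionMap (L := L) (IsCMField.complexConj L) hw) (placeForm (Matrix.of fun i j : Fin 2 => if i.val + j.val + 1 = 2 then (1 : L) else 0) w.1))) (hE₂ : ∀ g, ((E₂ g : ↥(unitaryGroupOfForm (galAdicCompletionMap (L := L) (IsCMField.complexConj L) hw) (placeForm (Matrix.of fun i j : Fin 2 => if i.val + j.val + 1 = 2 then (1 : L) else 0) w.1))) : GL (Fin 2) (w.1.adicCompletion L)) = ((localNonsplitEquiv (IsCMField.complexConj L) (Matrix.of fun i j : Fin 2 => if i.val + j.val + 1 = 2 then (1 : L) else 0) (IsCMField.complexConj_ne_one L) w hw g : ↥(unitaryGroupOfForm (galAdicCompletionMap (L := L) (IsCMField.complexConj L) hw) (placeForm (Matrix.of fun i j : Fin 2 => if i.val + j.val + 1 = 2 then (1 : L) else 0) w.1)))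 : GL (Fin 2) (w.1.adicCompletion L)))
    (t : ↥(Subgroup.centralizer ({t₀} : Set ((cmDatum L 2 (Matrix.of fun i j : Fin 2 => if i.val + j.val + 1 = 2 then (1 : L) else 0)).Local v × (cmDatum L 1 (Matrix.of fun i j : Fin 1 => if i.val + j.val + 1 = 1 then (1 : L) else 0)).Local v)))) (hreg : IsRegularElt ((t : ((cmDatum L 2 (Matrix.of fun i j : Fin 2 => if i.val + j.val + 1 = 2 then (1 : L) else 0)).Local v × (cmDatum L 1 (Matrix.of fun i j : Fin 1 => if i.val + j.val + 1 = 1 then (1 : L) else 0)).Local v)).1.val : GL (Fin 2) (LocalRing L v))) :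
    (((E₂ (t : ((cmDatum L 2 (Matrix.of fun i j : Fin 2 => if i.val + j.val + 1 = 2 then (1 : L) else 0)).Local v × (cmDatum L 1 (Matrix.of fun i j : Fin 1 => if i.val + j.val + 1 = 1 then (1 : L) else 0)).Local v)).1 : ↥(unitaryGroupOfForm (galAdicCompletionMap (L := L) (IsCMField.complexConj L) hw) (placeForm (Matrix.of fun i j : Fin 2 => if i.val + j.val + 1 = 2 then (1 : L) else 0) w.1))) : GL (Fin 2) (w.1.adicCompletion L)) : Matrix (Fin 2) (Fin 2) (w.1.adicCompletion L)) * (((Matrix.GeneralLinearGroup.map (Pi.evalRingHom (fun w' : PlacesOver L v => w'.1.adicCompletion L) w) P) : GL (Fin 2) (w.1.adicCompletion L)) : Matrix (Fin 2) (Fin 2) (w.1.adicCompletion L)) =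
        (((Matrix.GeneralLinearGroup.map (Pi.evalRingHom (fun w' : PlacesOver L v => w'.1.adicCompletion L) w) P) : GL (Fin 2) (w.1.adicCompletion L)) : Matrix (Fin 2) (Fin 2) (w.1.adicCompletion L)) * diagonal ![(((P⁻¹).val * (((t : ((cmDatum L 2 (Matrix.of fun i j : Fin 2 => if i.val + j.val + 1 = 2 then (1 : L) else 0)).Local v × (cmDatum L 1 (Matrix.of fun i j : Fin 1 => if i.val + j.val + 1 = 1 then (1 : L) else 0)).Local v))).1.val.val : Matrix (Fin 2) (Fin 2) (LocalRing L v)) * P.val) 0 0) w, (((P⁻¹).val * (((t : ((cmDatum L 2 (Matrix.of fun i j : Fin 2 => if i.val + j.val + 1 = 2 then (1 : L) else 0)).Local v × (cmDatum L 1 (Matrix.of fun i j : Fin 1 => if i.val + j.val + 1 = 1 then (1 : L) else 0)).Local v))).1.val.val : Matrix (Fin 2) (Fin 2) (LocalRing L v)) * P.val) 1 1) w] ∧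
      Function.Injective ![(((P⁻¹).val * (((t : ((cmDatum L 2 (Matrix.of fun i j : Fin 2 => if i.val + j.val + 1 = 2 then (1 : L) else 0)).Local v × (cmDatum L 1 (Matrix.of fun i j : Fin 1 => if i.val + j.val + 1 = 1 then (1 : L) else 0)).Local v))).1.val.val : Matrix (Fin 2) (Fin 2) (LocalRing L v)) * P.val) 0 0) w, (((P⁻¹).val * (((t : ((cmDatum L 2 (Matrix.of fun i j : Fin 2 => if i.val + j.val + 1 = 2 then (1 : L) else 0)).Local v × (cmDatum L 1 (Matrix.of fun i j : Fin 1 => if i.val + j.val + 1 = 1 then (1 : L) else 0)).Local v))).1.val.val : Matrix (Fin 2) (Fin 2) (LocalRing L v)) * P.val) 1 1) w] ∧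
      (∀ i, galAdicCompletionMap (L := L) (IsCMField.complexConj L) hw (![(((P⁻¹).val * (((t : ((cmDatum L 2 (Matrix.of fun i j : Fin 2 => if i.val + j.val + 1 = 2 then (1 : L) else 0)).Local v × (cmDatum L 1 (Matrix.of fun i j : Fin 1 => if i.val + j.val + 1 = 1 then (1 : L) else 0)).Local v))).1.val.val : Matrix (Fin 2) (Fin 2) (LocalRing L v)) * P.val) 0 0) w, (((P⁻¹).val * (((t : ((cmDatum L 2 (Matrix.of fun i j : Fin 2 => if i.val + j.val + 1 = 2 then (1 : L) else 0)).Local v × (cmDatum L 1 (Matrix.of fun i j : Fin 1 => if i.val + j.val + 1 = 1 then (1 : L) else 0)).Local v))).1.val.val : Matrix (Fin 2) (Fin 2) (LocalRing L v)) * P.val) 1 1) w] i) * ![(((P⁻¹).val * (((t : ((cmDatum L 2 (Matrix.of fun i j : Fin 2 => if i.val + j.val + 1 = 2 then (1 : L) else 0)).Local v × (cmDatum L 1 (Matrix.of fun i j : Fin 1 => if i.val + j.val + 1 = 1 then (1 : L) else 0)).Local v))).1.val.val : Matrix (Fin 2) (Fin 2) (LocalRing L v)) * P.val) 0 0) w,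 (((P⁻¹).val * (((t : ((cmDatum L 2 (Matrix.of fun i j : Fin 2 => if i.val + j.val + 1 = 2 then (1 : L) else 0)).Local v × (cmDatum L 1 (Matrix.of fun i j : Fin 1 => if i.val + j.val + 1 = 1 then (1 : L) else 0)).Local v))).1.val.val : Matrix (Fin 2) (Fin 2) (LocalRing L v)) * P.val) 1 1) w] i = 1) ∧
      Valued.v (![(((P⁻¹).val * (((t : ((cmDatum L 2 (Matrix.of fun i j : Fin 2 => if i.val + j.val + 1 = 2 then (1 : L) else 0)).Local v × (cmDatum L 1 (Matrix.of fun i j : Fin 1 => if i.val + j.val + 1 = 1 then (1 : L) else 0)).Local v))).1.val.val : Matrix (Fin 2) (Fin 2) (LocalRing L v)) * P.val) 0 0) w, (((P⁻¹).val * (((t : ((cmDatum L 2 (Matrix.of fun i j : Fin 2 => if i.val + j.val + 1 = 2 then (1 : L) else 0)).Local v × (cmDatum L 1 (Matrix.of fun i j : Fin 1 => if i.val + j.val + 1 = 1 then (1 : L) else 0)).Local v))).1.val.val : Matrix (Fin 2) (Fin 2) (LocalRing L v)) * P.val) 1 1) w] 0 - ![(((P⁻¹).val * (((t : ((cmDatum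 L 2 (Matrix.of fun i j : Fin 2 => if i.val + j.val + 1 = 2 then (1 : L) else 0)).Local v × (cmDatum L 1 (Matrix.of fun i j : Fin 1 => if i.val + j.val + 1 = 1 then (1 : L) else 0)).Local v))).1.val.val : Matrix (Fin 2) (Fin 2) (LocalRing L v)) * P.val) 0 0) w, (((P⁻¹).val * (((t : ((cmDatum L 2 (Matrix.of fun i j : Fin 2 => if i.val + j.val + 1 = 2 then (1 : L) else 0)).Local v × (cmDatum L 1 (Matrix.of fun i j : Fin 1 => if i.val + j.val + 1 = 1 then (1 : L) else 0)).Local v))).1.val.val : Matrix (Fin 2) (Fin 2) (LocalRing L v)) * P.val) 1 1) w] 1) =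
        Valued.v ϖ ^ (-WithZero.log (Valued.v (((((P⁻¹).val * (((t : ((cmDatum L 2 (Matrix.of fun i j : Fin 2 => if i.val + j.val + 1 = 2 then (1 : L) else 0)).Local v × (cmDatum L 1 (Matrix.of fun i j : Fin 1 => if i.val + j.val + 1 = 1 then (1 : L) else 0)).Local v))).1.val.val : Matrix (Fin 2) (Fin 2) (LocalRing L v)) * P.val) 0 0) - (((P⁻¹).val * (((t : ((cmDatum L 2 (Matrix.of fun i j : Fin 2 => if i.val + j.val + 1 = 2 then (1 : L) else 0)).Local v × (cmDatum L 1 (Matrix.of fun i j : Fin 1 => if i.val + j.val + 1 = 1 then (1 : L) else 0)).Local v))).1.val.val : Matrix (Fin 2) (Fin 2) (LocalRing L v)) * P.val) 1 1)) w))).toNat := by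
  have hσw : ∀ x : LocalRing L v, conjLocal L (IsCMField.complexConj L) v x w = galAdicCompletionMap (L := L) (IsCMField.complexConj L) hw (x w) :=
    fun x => conjLocal_apply_eq_galAdicCompletionMap L v w hw x
  refine ⟨?_, ?_, ?_, ?_⟩
  · have h := coe_localNonsplitEquiv_mul_map_eq L v w hw (t : ((cmDatum L 2 (Matrix.of fun i j : Fin 2 => if i.val + j.val + 1 = 2 then (1 : L) else 0)).Local v × (cmDatum L 1 (Matrix.of fun i j : Fin 1 => if i.val + j.val + 1 = 1 then (1 : L) else 0)).Local v)).1 P _ (frame_of_mem_centralizer L v w hw t₀ P d ht₀ hP hd1 t)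
    rw [hE₂, h, Matrix.diagonal_map (map_zero _)]
    congr 1
    funext i
    fin_cases i <;> rfl
  · refine injective_vecCons_two_S0r fun h => ?_
    exact ((isRegularElt_iff_frameEntry_ne L v w hw t₀ P d ht₀ hP hd1 t).1 hreg)
      ((LocalRing.eq_iff_apply_eq (IsCMField.complexConj L) (IsCMField.complexConj_ne_one L) w hw _ _).2 h)
  · intro i
    fin_cases i
    · have h := congrArg (fun x : LocalRing L v => x w) (conjLocal_frameEntry_mul_self_apply L v w hw t₀ P d ht₀ hP hd1 t 0)
      simpa only [Fin.zero_eta, Fin.mk_one, Matrix.cons_val_zero, Matrix.cons_val_one, Matrix.head_cons, Pi.mul_apply, Pi.one_apply, hσw] using h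
    · have h := congrArg (fun x : LocalRing L v => x w) (conjLocal_frameEntry_mul_self_apply L v w hw t₀ P d ht₀ hP hd1 t 1)
      simpa only [Fin.zero_eta, Fin.mk_one, Matrix.cons_val_zero, Matrix.cons_val_one, Matrix.head_cons, Pi.mul_apply, Pi.one_apply, hσw] using h
  · obtain ⟨h0, h1⟩ := valued_frameEntry_sub_ne_zero_le_one L v w hw t₀ P d ht₀ hP hd1 (t : ((cmDatum L 2 (Matrix.of fun i j : Fin 2 => if i.val + j.val + 1 = 2 then (1 : L) else 0)).Local v × (cmDatum L 1 (Matrix.of fun i j : Fin 1 => if i.val + j.val + 1 = 1 then (1 : L) else 0)).Local v)) t.2 hreg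
    have h := eq_exp_neg_one_pow_toNat_neg_log h0 h1
    simpa only [Matrix.cons_val_zero, Matrix.cons_val_one, Matrix.head_cons, Pi.sub_apply, hϖ] using h

end Frame

/-! ## §2 (S1-ram) The per-piece SIGNED depth expansion on `H_v`, edge piece -/

section Expansion

variable (L : Type) [Field L] [NumberField L] [IsCMField L] (v : HeightOneSpectrum (𝓞 ↥(maximalRealSubfield L)))
  (w : PlacesOver L v) (hw : IsCMField.complexConj L • w.1 = w.1)
  [MeasurableSpace ((cmDatum L 2 (Matrix.of fun i j : Fin 2 => if i.val + j.val + 1 = 2 then (1 : L) else 0)).Local v × (cmDatum L 1 (Matrix.of fun i j : Fin 1 => if i.val + j.val + 1 = 1 then (1 : L) else 0)).Local v)] [BorelSpace ((cmDatum L 2 (Matrix.of fun i j : Fin 2 => if i.val + j.val + 1 = 2 then (1 : L) else 0)).Local v × (cmDatum L 1 (Matrix.of fun i j : Fin 1 => if i.val + j.val + 1 = 1 then (1 : L) else 0)).Local v)] (ν : Measure ((cmDatum L 2 (Matrix.of fun i j : Fin 2 => if i.val + j.val + 1 = 2 then (1 : L) else 0)).Local v × (cmDatum L 1 (Matrix.of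 fun i j : Fin 1 => if i.val + j.val + 1 = 1 then (1 : L) else 0)).Local v)) [ν.IsMulRightInvariant]
  {E : Type*} [NormedAddCommGroup E] [NormedSpace ℝ E] [CompleteSpace E]

-- `L_w`-sized statement: elaboration budget only (no search)
set_option maxHeartbeats 1600000 in
include hw in
/-- **S1-ram — THE PER-PIECE SIGNED DEPTH EXPANSION ON `H_v` AT A TAMELY RAMIFIED PLACE, EDGE PIECE.**  See the module docstring: ★ I-7
`integral_conj_eq_smul_finsum_onePlace_of_isCompact` ∘ ★ α2 `finsum_fixedBy_conj_eq_signedDepthExpansion_ramified` at `F := L_w`, `σ := σ_w`, `J := (Φ₂)_w`, with α2's generic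
hypotheses (`hdock`, `hfin`, `hq`, DVR, `2 ∈ 𝒪ˣ`) discharged at `w`.  The frame `(Q, u, N, h, r)` is the NORMALISED one-place frame of `x.1` (binders; the END-brick
assembler supplies it for `t` from ★ A-p01 `exists_diagonal_unit_frame_antidiagTwo_of_ramified` and for the partner `e t` as `(D·Q, u, N, u₀ • h, r)`).
[cite: LabesseLanglands1979, §2 Lemma 2.1 pp. 8–9] [cite: Rogawski1990, §4.9 pp. 54–56, Lemma 4.9.3] [cite: Kottwitz1988, §2] -/
theorem integral_conj_eq_smul_signedDepthExpansion_onePlace_ramified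
    (he : v.asIdeal.ramificationIdx' w.1.asIdeal ≠ 1) (h2 : Valued.v (2 : w.1.adicCompletion L) = 1)
    (ϖ : (w.1.adicCompletion L)ˣ) (hϖ : Valued.v (ϖ : w.1.adicCompletion L) = WithZero.exp (-1 : ℤ)) (hσϖ : galAdicCompletionMap (L := L) (IsCMField.complexConj L) hw (ϖ : w.1.adicCompletion L) = -(ϖ : w.1.adicCompletion L))
    (σO : 𝒪[w.1.adicCompletion L] →+* 𝒪[w.1.adicCompletion L]) (hσO' : ∀ x : 𝒪[w.1.adicCompletion L], ((σO x : 𝒪[w.1.adicCompletion L]) : w.1.adicCompletion L) = galAdicCompletionMap (L := L) (IsCMField.complexConj L) hw x)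
    (hσσ : ∀ x, σO (σO x) = x) (hres : ∀ x : 𝒪[w.1.adicCompletion L], σO x - x ∈ IsLocalRing.maximalIdeal 𝒪[w.1.adicCompletion L])
    {η : 𝒪[w.1.adicCompletion L]} (hηu : IsUnit η) (hση : σO η = η) (hη : ¬ IsSquare (IsLocalRing.residue 𝒪[w.1.adicCompletion L] η))
    (K : Subgroup ((cmDatum L 2 (Matrix.of fun i j : Fin 2 => if i.val + j.val + 1 = 2 then (1 : L) else 0)).Local v)) (E₂ : (cmDatum L 2 (Matrix.of fun i j : Fin 2 => if i.val + j.val + 1 = 2 then (1 : L) else 0)).Local v ≃ₜ* ↥(unitaryGroupOfForm (galAdicCompletionMap (L := L) (IsCMField.complexConj L) hw) (placeForm (Matrix.of fun i j : Fin 2 => if i.val + j.val + 1 = 2 then (1 : L) else 0) w.1))) (hK : ∀ g, g ∈ K ↔ E₂ g ∈ (glInt 2 (w.1.adicCompletion L)).subgroupOf (unitaryGroupOfForm (galAdicCompletionMap (L := L) (IsCMField.complexConj L) hw) (placeForm (Matrix.of fun i j : Fin 2 => if i.val + j.val + 1 = 2 then (1 : L) else 0) w.1)))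
    (hKo : IsOpen ((K.prod (⊤ : Subgroup ((cmDatum L 1 (Matrix.of fun i j : Fin 1 => if i.val + j.val + 1 = 1 then (1 : L) else 0)).Local v)) : Subgroup ((cmDatum L 2 (Matrix.of fun i j : Fin 2 => if i.val + j.val + 1 = 2 then (1 : L) else 0)).Local v × (cmDatum L 1 (Matrix.of fun i j : Fin 1 => if i.val + j.val + 1 = 1 then (1 : L) else 0)).Local v)) : Set ((cmDatum L 2 (Matrix.of fun i j : Fin 2 => if i.val + j.val + 1 = 2 then (1 : L) else 0)).Local v × (cmDatum L 1 (Matrix.of fun i j : Fin 1 => if i.val + j.val + 1 = 1 then (1 : L) else 0)).Local v)))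
    (hKν : ν ((K.prod (⊤ : Subgroup ((cmDatum L 1 (Matrix.of fun i j : Fin 1 => if i.val + j.val + 1 = 1 then (1 : L) else 0)).Local v)) : Subgroup ((cmDatum L 2 (Matrix.of fun i j : Fin 2 => if i.val + j.val + 1 = 2 then (1 : L) else 0)).Local v × (cmDatum L 1 (Matrix.of fun i j : Fin 1 => if i.val + j.val + 1 = 1 then (1 : L) else 0)).Local v)) : Set ((cmDatum L 2 (Matrix.of fun i j : Fin 2 => if i.val + j.val + 1 = 2 then (1 : L) else 0)).Local v × (cmDatum L 1 (Matrix.of fun i j : Fin 1 => if i.val + j.val + 1 = 1 then (1 : L) else 0)).Local v)) ≠ ⊤)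
    (x : ((cmDatum L 2 (Matrix.of fun i j : Fin 2 => if i.val + j.val + 1 = 2 then (1 : L) else 0)).Local v × (cmDatum L 1 (Matrix.of fun i j : Fin 1 => if i.val + j.val + 1 = 1 then (1 : L) else 0)).Local v)) {Q : GL (Fin 2) (w.1.adicCompletion L)} {u : Fin 2 → w.1.adicCompletion L}
    (hQ : (((E₂ x.1 : ↥(unitaryGroupOfForm (galAdicCompletionMap (L := L) (IsCMField.complexConj L) hw) (placeForm (Matrix.of fun i j : Fin 2 => if i.val + j.val + 1 = 2 then (1 : L) else 0) w.1))) : GL (Fin 2) (w.1.adicCompletion L)) : Matrix (Fin 2) (Fin 2) (w.1.adicCompletion L)) * (Q : Matrix (Fin 2) (Fin 2) (w.1.adicCompletion L)) = (Q : Matrix (Fin 2) (Fin 2) (w.1.adicCompletion L)) * diagonal u) (hu : Function.Injective u)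
    (hu1 : ∀ i, galAdicCompletionMap (L := L) (IsCMField.complexConj L) hw (u i) * u i = 1) {N : ℕ} (hN : Valued.v (u 0 - u 1) = Valued.v (ϖ : w.1.adicCompletion L) ^ N)
    {h : Fin 2 → w.1.adicCompletion L} (hQh : formCongr (galAdicCompletionMap (L := L) (IsCMField.complexConj L) hw) Q (placeForm (Matrix.of fun i j : Fin 2 => if i.val + j.val + 1 = 2 then (1 : L) else 0) w.1) = Matrix.diagonal h) (hh : ∀ i, Valued.v (h i) = 1)
    (hσh : ∀ i, galAdicCompletionMap (L := L) (IsCMField.complexConj L) hw (h i) = h i) (r : 𝒪[w.1.adicCompletion L]) (hr : h 0 * (r : w.1.adicCompletion L) = -h 1) (hsq : IsSquare (IsLocalRing.residue 𝒪[w.1.adicCompletion L] r))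
    {m : ℕ} (hmN : m ≤ N) (Km : Subgroup ↥(unitaryGroupOfForm (galAdicCompletionMap (L := L) (IsCMField.complexConj L) hw) (placeForm (Matrix.of fun i j : Fin 2 => if i.val + j.val + 1 = 2 then (1 : L) else 0) w.1)))
    (hKm : ∀ y : ↥(unitaryGroupOfForm (galAdicCompletionMap (L := L) (IsCMField.complexConj L) hw) (placeForm (Matrix.of fun i j : Fin 2 => if i.val + j.val + 1 = 2 then (1 : L) else 0) w.1)), (∀ r s, (ϖ : w.1.adicCompletion L) ^ (-(m : ℤ)) * ((((y : ↥(unitaryGroupOfForm (galAdicCompletionMap (L := L) (IsCMField.complexConj L) hw) (placeForm (Matrix.of fun i j : Fin 2 => if i.val + j.val + 1 = 2 then (1 : L) else 0) w.1))) : GL (Fin 2) (w.1.adicCompletion L)) : Matrix (Fin 2) (Fin 2) (w.1.adicCompletion L)) - 1) r s ∈ 𝒪[w.1.adicCompletion L]) → y ∈ Km)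
    (φ : ((cmDatum L 2 (Matrix.of fun i j : Fin 2 => if i.val + j.val + 1 = 2 then (1 : L) else 0)).Local v × (cmDatum L 1 (Matrix.of fun i j : Fin 1 => if i.val + j.val + 1 = 1 then (1 : L) else 0)).Local v) → E) (hφs : support φ ⊆ ((K.prod (⊤ : Subgroup ((cmDatum L 1 (Matrix.of fun i j : Fin 1 => if i.val + j.val + 1 = 1 then (1 : L) else 0)).Local v)) : Subgroup ((cmDatum L 2 (Matrix.of fun i j : Fin 2 => if i.val + j.val + 1 = 2 then (1 : L) else 0)).Local v × (cmDatum L 1 (Matrix.of fun i j : Fin 1 => if i.val + j.val + 1 = 1 then (1 : L) else 0)).Local v)) : Set ((cmDatum L 2 (Matrix.of fun i j : Fin 2 => if i.val + j.val + 1 = 2 then (1 : L) else 0)).Local v × (cmDatum L 1 (Matrix.of fun i j : Fin 1 => if i.val + j.val + 1 = 1 then (1 : L) else 0)).Local v)))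
    (hφK : ∀ k ∈ (K.prod (⊤ : Subgroup ((cmDatum L 1 (Matrix.of fun i j : Fin 1 => if i.val + j.val + 1 = 1 then (1 : L) else 0)).Local v)) : Subgroup ((cmDatum L 2 (Matrix.of fun i j : Fin 2 => if i.val + j.val + 1 = 2 then (1 : L) else 0)).Local v × (cmDatum L 1 (Matrix.of fun i j : Fin 1 => if i.val + j.val + 1 = 1 then (1 : L) else 0)).Local v)), ∀ y, φ (k * y * k⁻¹) = φ y)
    (hφm : ∀ x' : ↥(unitaryGroupOfForm (galAdicCompletionMap (L := L) (IsCMField.complexConj L) hw) (placeForm (Matrix.of fun i j : Fin 2 => if i.val + j.val + 1 = 2 then (1 : L) else 0) w.1)), ∀ y ∈ Km, φ (E₂.symm (x' * y), x.2) = φ (E₂.symm x', x.2))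
    (hc : IsCompact {y : ((cmDatum L 2 (Matrix.of fun i j : Fin 2 => if i.val + j.val + 1 = 2 then (1 : L) else 0)).Local v × (cmDatum L 1 (Matrix.of fun i j : Fin 1 => if i.val + j.val + 1 = 1 then (1 : L) else 0)).Local v) | y * x * y⁻¹ ∈ ((K.prod (⊤ : Subgroup ((cmDatum L 1 (Matrix.of fun i j : Fin 1 => if i.val + j.val + 1 = 1 then (1 : L) else 0)).Local v)) : Subgroup ((cmDatum L 2 (Matrix.of fun i j : Fin 2 => if i.val + j.val + 1 = 2 then (1 : L) else 0)).Local v × (cmDatum L 1 (Matrix.of fun i j : Fin 1 => if i.val + j.val + 1 = 1 then (1 : L) else 0)).Local v)) : Set ((cmDatum L 2 (Matrix.of fun i j : Fin 2 => if i.val + j.val + 1 = 2 then (1 : L) else 0)).Local v × (cmDatum L 1 (Matrix.of fun i j : Fin 1 => if i.val + j.val + 1 = 1 then (1 : L) else 0)).Local v))}) :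
    ∃ (e : ℕ → ℕ) (xm : ↥(unitaryGroupOfForm (galAdicCompletionMap (L := L) (IsCMField.complexConj L) hw) (placeForm (Matrix.of fun i j : Fin 2 => if i.val + j.val + 1 = 2 then (1 : L) else 0) w.1))) (xs : ℕ → ↥(unitaryGroupOfForm (galAdicCompletionMap (L := L) (IsCMField.complexConj L) hw) (placeForm (Matrix.of fun i j : Fin 2 => if i.val + j.val + 1 = 2 then (1 : L) else 0) w.1))), (∀ i, e i ≤ 1) ∧
      (∀ i < m, Odd i → ∀ S : 𝒪[w.1.adicCompletion L], (S : w.1.adicCompletion L) = (-1) ^ ((N + i) / 2 + 1) * u 1 * ((u 0 - u 1) * ((ϖ : w.1.adicCompletion L) ^ N)⁻¹) * h 0 →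
        (e i = 0 ↔ IsSquare (IsLocalRing.residue 𝒪[w.1.adicCompletion L] S))) ∧
      (((xm : ↥(unitaryGroupOfForm (galAdicCompletionMap (L := L) (IsCMField.complexConj L) hw) (placeForm (Matrix.of fun i j : Fin 2 => if i.val + j.val + 1 = 2 then (1 : L) else 0) w.1))) : GL (Fin 2) (w.1.adicCompletion L)) : Matrix (Fin 2) (Fin 2) (w.1.adicCompletion L)) = u 1 • (1 : Matrix (Fin 2) (Fin 2) (w.1.adicCompletion L)) ∧
      (∀ i, Odd i → (((xs i : ↥(unitaryGroupOfForm (galAdicCompletionMap (L := L) (IsCMField.complexConj L) hw) (placeForm (Matrix.of fun i j : Fin 2 => if i.val + j.val + 1 = 2 then (1 : L) else 0) w.1))) : GL (Fin 2) (w.1.adicCompletion L)) : Matrix (Fin 2) (Fin 2) (w.1.adicCompletion L)) = u 1 • ((1 : Matrix (Fin 2) (Fin 2) (w.1.adicCompletion L)) + (ϖ : w.1.adicCompletion L) ^ i • !![0, ((η : 𝒪[w.1.adicCompletion L]) : w.1.adicCompletion L) ^ (e i); 0, 0])) ∧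
      ∫ y, φ (y * x * y⁻¹) ∂ν = ν.real ((K.prod (⊤ : Subgroup ((cmDatum L 1 (Matrix.of fun i j : Fin 1 => if i.val + j.val + 1 = 1 then (1 : L) else 0)).Local v)) : Subgroup ((cmDatum L 2 (Matrix.of fun i j : Fin 2 => if i.val + j.val + 1 = 2 then (1 : L) else 0)).Local v × (cmDatum L 1 (Matrix.of fun i j : Fin 1 => if i.val + j.val + 1 = 1 then (1 : L) else 0)).Local v)) : Set ((cmDatum L 2 (Matrix.of fun i j : Fin 2 => if i.val + j.val + 1 = 2 then (1 : L) else 0)).Local v × (cmDatum L 1 (Matrix.of fun i j : Fin 1 => if i.val + j.val + 1 = 1 then (1 : L) else 0)).Local v)) •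
        ((∑ j ∈ (range (N + 1)).filter (fun j => j % 2 = 0 ∧ j + m ≤ N), (if j = 0 then 1 else 2 * Nat.card (𝓞 ↥(maximalRealSubfield L) ⧸ v.asIdeal) ^ (j / 2))) • φ (E₂.symm xm, x.2) +
          ∑ i ∈ range m, (if i ≤ N ∧ (N - i) % 2 = 0 then (if N - i = 0 then 1 else 2 * Nat.card (𝓞 ↥(maximalRealSubfield L) ⧸ v.asIdeal) ^ ((N - i) / 2)) else 0) • φ (E₂.symm (xs i), x.2)) := by
  classical
  have hc1 : IsCMField.complexConj L ≠ 1 := IsCMField.complexConj_ne_one L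
  -- §a the generic data of ★ α2 at `w`
  have hϖ' : IsUniformizingElement (ϖ : w.1.adicCompletion L) := isUniformizingElement_of_v_eq hϖ
  haveI : IsDiscreteValuationRing 𝒪[w.1.adicCompletion L] := isDiscreteValuationRing_integer_of_compatible hϖ
  have h2O : IsUnit (2 : 𝒪[w.1.adicCompletion L]) := by
    rw [(Valuation.integer.integers (valuation (w.1.adicCompletion L))).isUnit_iff_valuation_eq_one, map_ofNat]
    exact (v_eq_one_iff_valuation_eq_one (2 : w.1.adicCompletion L)).1 h2
  obtain ⟨-, -, -, -, hq⟩ := exists_integer_involution_complexConj_of_ramified L v w hw he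
  have huv : ∀ i, valuation (w.1.adicCompletion L) (u i) = 1 := fun i => valuation_eq_one_of_galAdicCompletionMap_mul_self L v w hw (hu1 i)
  have hN' : valuation (w.1.adicCompletion L) (u 0 - u 1) = valuation (w.1.adicCompletion L) ((ϖ : w.1.adicCompletion L) ^ N) := by rw [← v_eq_iff_valuation_eq, hN, map_pow]
  have hh' : ∀ i, valuation (w.1.adicCompletion L) (h i) = 1 := fun i => (v_eq_one_iff_valuation_eq_one (h i)).1 (hh i)
  -- the form as a unit and its literal value
  have hJ : (((isUnit_placeForm_antidiagOne (E := L) 2 w.1).unit : GL (Fin 2) (w.1.adicCompletion L)) : Matrix (Fin 2) (Fin 2) (w.1.adicCompletion L)) = !![0, 1; 1, 0] :=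
    placeForm_antidiagTwo_eq_swap_lit L v w
  have hJi := unit_placeForm_antidiagOne_mem_glInt (E := L) 2 w.1
  have hJh := placeForm_antidiagTwo_hermitian L v w hw
  -- §b the ramified DOCKING at `w`
  have hdock : ∀ Λ : Submodule 𝒪[w.1.adicCompletion L] (Fin 2 → w.1.adicCompletion L),
      (∃ y ∈ unitaryGroupOfForm (galAdicCompletionMap (L := L) (IsCMField.complexConj L) hw) (placeForm (Matrix.of fun i j : Fin 2 => if i.val + j.val + 1 = 2 then (1 : L) else 0) w.1), Λ = Submodule.span 𝒪[w.1.adicCompletion L] (Set.range ((y : Matrix (Fin 2) (Fin 2) (w.1.adicCompletion L)))ᵀ)) ↔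
        (∃ g : GL (Fin 2) (w.1.adicCompletion L), (∃ J' ∈ glInt 2 (w.1.adicCompletion L), (J' : Matrix (Fin 2) (Fin 2) (w.1.adicCompletion L)) = formCongr (galAdicCompletionMap (L := L) (IsCMField.complexConj L) hw) g (placeForm (Matrix.of fun i j : Fin 2 => if i.val + j.val + 1 = 2 then (1 : L) else 0) w.1)) ∧
          Λ = Submodule.span 𝒪[w.1.adicCompletion L] (Set.range ((g : Matrix (Fin 2) (Fin 2) (w.1.adicCompletion L)))ᵀ)) := by
    intro Λ
    constructor
    · rintro ⟨y, hy, rfl⟩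
      exact ⟨y, ⟨(isUnit_placeForm_antidiagOne (E := L) 2 w.1).unit, hJi, (mem_unitaryGroupOfForm_iff.1 hy).symm⟩, rfl⟩
    · rintro ⟨g, hg, rfl⟩
      obtain ⟨y, hy, k, hk, rfl⟩ := exists_mem_unitaryGroupOfForm_mul_of_selfDual_of_ramified (IsCMField.complexConj L) w hc1 hw he h2O
        (isUnit_placeForm_antidiagOne (E := L) 2 w.1).unit hJi hJh g hg
      refine ⟨y, hy, ?_⟩
      rw [eq_comm, span_range_transpose_eq_iff, inv_mul_cancel_left]
      exact hk
  -- §c FINITENESS of `Fix_{E₂ x.1}(U ⧸ K⁰)`: the cosets embed into the finite set of `E₂ x.1`-stable self-dual lattices (★ L2a + ★ R2-D)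
  have hQγ : (((Q⁻¹ * ((E₂ x.1 : ↥(unitaryGroupOfForm (galAdicCompletionMap (L := L) (IsCMField.complexConj L) hw) (placeForm (Matrix.of fun i j : Fin 2 => if i.val + j.val + 1 = 2 then (1 : L) else 0) w.1))) : GL (Fin 2) (w.1.adicCompletion L)) * Q : GL (Fin 2) (w.1.adicCompletion L))) : Matrix (Fin 2) (Fin 2) (w.1.adicCompletion L)) = !![u 0, 0; 0, u 1] := by
    rw [Units.val_mul, Units.val_mul, Matrix.mul_assoc, hQ, ← Matrix.mul_assoc, ← Units.val_mul, inv_mul_cancel, Units.val_one, Matrix.one_mul]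
    ext i j; fin_cases i <;> fin_cases j <;> simp
  have hform0 : formCongr (galAdicCompletionMap (L := L) (IsCMField.complexConj L) hw) Q (placeForm (Matrix.of fun i j : Fin 2 => if i.val + j.val + 1 = 2 then (1 : L) else 0) w.1) = (ϖ : w.1.adicCompletion L) ^ (-((0 : ℕ) : ℤ)) • Matrix.diagonal h := by
    rw [hQh, Nat.cast_zero, neg_zero, zpow_zero, one_smul]
  have hfinS := (finite_and_ncard_selfDualStable_of_diagonal_frame (galAdicCompletionMap (L := L) (IsCMField.complexConj L) hw) hϖ' σO hσO' hσσ hres h2O hσϖ (hh' 0) (hh' 1) hσh r hr hsq (Nat.zero_le 1)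
    (placeForm (Matrix.of fun i j : Fin 2 => if i.val + j.val + 1 = 2 then (1 : L) else 0) w.1) ((E₂ x.1 : ↥(unitaryGroupOfForm (galAdicCompletionMap (L := L) (IsCMField.complexConj L) hw) (placeForm (Matrix.of fun i j : Fin 2 => if i.val + j.val + 1 = 2 then (1 : L) else 0) w.1))) : GL (Fin 2) (w.1.adicCompletion L)) Q hQγ (huv 0) (huv 1) hN' hform0 hq 0).1
  have hfin : (MulAction.fixedBy (↥(unitaryGroupOfForm (galAdicCompletionMap (L := L) (IsCMField.complexConj L) hw) (placeForm (Matrix.of fun i j : Fin 2 => if i.val + j.val + 1 = 2 then (1 : L) else 0) w.1)) ⧸ (glInt 2 (w.1.adicCompletion L)).subgroupOf (unitaryGroupOfForm (galAdicCompletionMap (L := L) (IsCMField.complexConj L) hw) (placeForm (Matrix.of fun i j : Fin 2 => if i.val + j.val + 1 = 2 then (1 : L) else 0) w.1))) (E₂ x.1)).Finite := by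
    have himg : (fun q : ↥(unitaryGroupOfForm (galAdicCompletionMap (L := L) (IsCMField.complexConj L) hw) (placeForm (Matrix.of fun i j : Fin 2 => if i.val + j.val + 1 = 2 then (1 : L) else 0) w.1)) ⧸ (glInt 2 (w.1.adicCompletion L)).subgroupOf (unitaryGroupOfForm (galAdicCompletionMap (L := L) (IsCMField.complexConj L) hw) (placeForm (Matrix.of fun i j : Fin 2 => if i.val + j.val + 1 = 2 then (1 : L) else 0) w.1)) => Submodule.span 𝒪[w.1.adicCompletion L] (Set.range ((((q.out : ↥(unitaryGroupOfForm (galAdicCompletionMap (L := L) (IsCMField.complexConj L) hw) (placeForm (Matrix.of fun i j : Fin 2 => if i.val + j.val + 1 = 2 then (1 : L) else 0) w.1))) : GL (Fin 2) (w.1.adicCompletion L)) : Matrix (Fin 2) (Fin 2) (w.1.adicCompletion L)))ᵀ)) ''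
          {q ∈ MulAction.fixedBy (↥(unitaryGroupOfForm (galAdicCompletionMap (L := L) (IsCMField.complexConj L) hw) (placeForm (Matrix.of fun i j : Fin 2 => if i.val + j.val + 1 = 2 then (1 : L) else 0) w.1)) ⧸ (glInt 2 (w.1.adicCompletion L)).subgroupOf (unitaryGroupOfForm (galAdicCompletionMap (L := L) (IsCMField.complexConj L) hw) (placeForm (Matrix.of fun i j : Fin 2 => if i.val + j.val + 1 = 2 then (1 : L) else 0) w.1))) (E₂ x.1) | True} =
        {Λ : Submodule 𝒪[w.1.adicCompletion L] (Fin 2 → w.1.adicCompletion L) |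
          (∃ u ∈ unitaryGroupOfForm (galAdicCompletionMap (L := L) (IsCMField.complexConj L) hw) (placeForm (Matrix.of fun i j : Fin 2 => if i.val + j.val + 1 = 2 then (1 : L) else 0) w.1), Λ = Submodule.span 𝒪[w.1.adicCompletion L] (Set.range ((u : Matrix (Fin 2) (Fin 2) (w.1.adicCompletion L)))ᵀ)) ∧
            Λ.map ((Matrix.toLin' ((((E₂ x.1 : ↥(unitaryGroupOfForm (galAdicCompletionMap (L := L) (IsCMField.complexConj L) hw) (placeForm (Matrix.of fun i j : Fin 2 => if i.val + j.val + 1 = 2 then (1 : L) else 0) w.1))) : GL (Fin 2) (w.1.adicCompletion L)) : Matrix (Fin 2) (Fin 2) (w.1.adicCompletion L)))).restrictScalars 𝒪[w.1.adicCompletion L]) = Λ ∧ True} :=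
      image_sep_fixedBy_unitary_eq (galAdicCompletionMap (L := L) (IsCMField.complexConj L) hw) (isUnit_placeForm_antidiagOne (E := L) 2 w.1).unit (E₂ x.1) (fun _ => True)
    have hsep : {q ∈ MulAction.fixedBy (↥(unitaryGroupOfForm (galAdicCompletionMap (L := L) (IsCMField.complexConj L) hw) (placeForm (Matrix.of fun i j : Fin 2 => if i.val + j.val + 1 = 2 then (1 : L) else 0) w.1)) ⧸ (glInt 2 (w.1.adicCompletion L)).subgroupOf (unitaryGroupOfForm (galAdicCompletionMap (L := L) (IsCMField.complexConj L) hw) (placeForm (Matrix.of fun i j : Fin 2 => if i.val + j.val + 1 = 2 then (1 : L) else 0) w.1))) (E₂ x.1) | True} = MulAction.fixedBy (↥(unitaryGroupOfForm (galAdicCompletionMap (L := L) (IsCMField.complexConj L) hw) (placeForm (Matrix.of fun i j : Fin 2 => if i.val + j.val + 1 = 2 then (1 : L) else 0) w.1)) ⧸ (glInt 2 (w.1.adicCompletion L)).subgroupOf (unitaryGroupOfForm (galAdicCompletionMap (L := L) (IsCMField.complexConj L) hw) (placeForm (Matrix.of fun i j : Fin 2 => if i.val + j.val + 1 = 2 then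 (1 : L) else 0) w.1))) (E₂ x.1) := by
      ext q; simp only [Set.mem_setOf_eq, and_true]
    rw [hsep] at himg
    refine Set.Finite.of_finite_image (s := MulAction.fixedBy (↥(unitaryGroupOfForm (galAdicCompletionMap (L := L) (IsCMField.complexConj L) hw) (placeForm (Matrix.of fun i j : Fin 2 => if i.val + j.val + 1 = 2 then (1 : L) else 0) w.1)) ⧸ (glInt 2 (w.1.adicCompletion L)).subgroupOf (unitaryGroupOfForm (galAdicCompletionMap (L := L) (IsCMField.complexConj L) hw) (placeForm (Matrix.of fun i j : Fin 2 => if i.val + j.val + 1 = 2 then (1 : L) else 0) w.1))) (E₂ x.1))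
      (f := fun q : ↥(unitaryGroupOfForm (galAdicCompletionMap (L := L) (IsCMField.complexConj L) hw) (placeForm (Matrix.of fun i j : Fin 2 => if i.val + j.val + 1 = 2 then (1 : L) else 0) w.1)) ⧸ (glInt 2 (w.1.adicCompletion L)).subgroupOf (unitaryGroupOfForm (galAdicCompletionMap (L := L) (IsCMField.complexConj L) hw) (placeForm (Matrix.of fun i j : Fin 2 => if i.val + j.val + 1 = 2 then (1 : L) else 0) w.1)) => Submodule.span 𝒪[w.1.adicCompletion L] (Set.range ((((q.out : ↥(unitaryGroupOfForm (galAdicCompletionMap (L := L) (IsCMField.complexConj L) hw) (placeForm (Matrix.of fun i j : Fin 2 => if i.val + j.val + 1 = 2 then (1 : L) else 0) w.1))) : GL (Fin 2) (w.1.adicCompletion L)) : Matrix (Fin 2) (Fin 2) (w.1.adicCompletion L)))ᵀ)) ?_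
      (injOn_span_out_unitary (galAdicCompletionMap (L := L) (IsCMField.complexConj L) hw) (isUnit_placeForm_antidiagOne (E := L) 2 w.1).unit _)
    rw [himg]
    refine hfinS.subset fun Λ hΛ => ?_
    obtain ⟨hU, hstab, -⟩ := hΛ
    exact ⟨(hdock Λ).1 hU, hstab⟩
  -- §d ★ α2 for the one-place function `y ↦ φ (E₂⁻¹ y, x.2)`
  have hφAd : ∀ k ∈ (glInt 2 (w.1.adicCompletion L)).subgroupOf (unitaryGroupOfForm (galAdicCompletionMap (L := L) (IsCMField.complexConj L) hw) (placeForm (Matrix.of fun i j : Fin 2 => if i.val + j.val + 1 = 2 then (1 : L) else 0) w.1)), ∀ y : ↥(unitaryGroupOfForm (galAdicCompletionMap (L := L) (IsCMField.complexConj L) hw) (placeForm (Matrix.of fun i j : Fin 2 => if i.val + j.val + 1 = 2 then (1 : L) else 0) w.1)), (fun y : ↥(unitaryGroupOfForm (galAdicCompletionMap (L := L) (IsCMField.complexConj L) hw) (placeForm (Matrix.of fun i j : Fin 2 => if i.val + j.val + 1 = 2 then (1 : L) else 0) w.1)) => φ (E₂.symm y, x.2)) (k * y * k⁻¹) = (fun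 y : ↥(unitaryGroupOfForm (galAdicCompletionMap (L := L) (IsCMField.complexConj L) hw) (placeForm (Matrix.of fun i j : Fin 2 => if i.val + j.val + 1 = 2 then (1 : L) else 0) w.1)) => φ (E₂.symm y, x.2)) y := by
    intro k hk y
    show φ (E₂.symm (k * y * k⁻¹), x.2) = φ (E₂.symm y, x.2)
    have hk' : (E₂.symm k, (1 : (cmDatum L 1 (Matrix.of fun i j : Fin 1 => if i.val + j.val + 1 = 1 then (1 : L) else 0)).Local v)) ∈ (K.prod (⊤ : Subgroup ((cmDatum L 1 (Matrix.of fun i j : Fin 1 => if i.val + j.val + 1 = 1 then (1 : L) else 0)).Local v)) : Subgroup ((cmDatum L 2 (Matrix.of fun i j : Fin 2 => if i.val + j.val + 1 = 2 then (1 : L) else 0)).Local v × (cmDatum L 1 (Matrix.of fun i j : Fin 1 => if i.val + j.val + 1 = 1 then (1 : L) else 0)).Local v)) := by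
      refine Subgroup.mem_prod.2 ⟨(hK _).2 ?_, Subgroup.mem_top _⟩
      rw [ContinuousMulEquiv.apply_symm_apply]
      exact hk
    have h := hφK _ hk' (E₂.symm y, x.2)
    rw [map_mul, map_mul, map_inv]
    simpa only [Prod.mk_mul_mk, Prod.inv_mk, inv_one, one_mul, mul_one] using h
  have hφm' : ∀ z : ↥(unitaryGroupOfForm (galAdicCompletionMap (L := L) (IsCMField.complexConj L) hw) (placeForm (Matrix.of fun i j : Fin 2 => if i.val + j.val + 1 = 2 then (1 : L) else 0) w.1)), ∀ y ∈ Km, (fun y : ↥(unitaryGroupOfForm (galAdicCompletionMap (L := L) (IsCMField.complexConj L) hw) (placeForm (Matrix.of fun i j : Fin 2 => if i.val + j.val + 1 = 2 then (1 : L) else 0) w.1)) => φ (E₂.symm y, x.2)) (z * y) = (fun y : ↥(unitaryGroupOfForm (galAdicCompletionMap (L := L) (IsCMField.complexConj L) hw) (placeForm (Matrix.of fun i j : Fin 2 => if i.val + j.val + 1 = 2 then (1 : L) else 0) w.1)) => φ (E₂.symm y, x.2)) z :=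
    fun z y hy => hφm z y hy
  obtain ⟨e, xm, xs, he1, hbit, hxm, hxs, hsum⟩ := finsum_fixedBy_conj_eq_signedDepthExpansion_ramified (galAdicCompletionMap (L := L) (IsCMField.complexConj L) hw) hϖ' hσϖ σO hσO' hσσ h2O hres hηu hση hη hq
    (isUnit_placeForm_antidiagOne (E := L) 2 w.1).unit hJ (γ := E₂ x.1) hQ hu hu1 huv hN' hQh (hh' 0) (hh' 1) hσh r hr hsq hdock hfin hmN Km hKm
    (fun y : ↥(unitaryGroupOfForm (galAdicCompletionMap (L := L) (IsCMField.complexConj L) hw) (placeForm (Matrix.of fun i j : Fin 2 => if i.val + j.val + 1 = 2 then (1 : L) else 0) w.1)) => φ (E₂.symm y, x.2)) hφAd hφm'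
  refine ⟨e, xm, xs, he1, hbit, hxm, hxs, ?_⟩
  -- §e ★ I-7: unfold the orbital integral down to the one-place fixed-point sum, then substitute ★ α2
  rw [integral_conj_eq_smul_finsum_onePlace_of_isCompact L v w hw ν K ((glInt 2 (w.1.adicCompletion L)).subgroupOf (unitaryGroupOfForm (galAdicCompletionMap (L := L) (IsCMField.complexConj L) hw) (placeForm (Matrix.of fun i j : Fin 2 => if i.val + j.val + 1 = 2 then (1 : L) else 0) w.1))) E₂ hK hKo hKν x φ hφs hφK hc]
  exact congrArg (fun z : E => ν.real ((K.prod (⊤ : Subgroup ((cmDatum L 1 (Matrix.of fun i j : Fin 1 => if i.val + j.val + 1 = 1 then (1 : L) else 0)).Local v)) : Subgroup ((cmDatum L 2 (Matrix.of fun i j : Fin 2 => if i.val + j.val + 1 = 2 then (1 : L) else 0)).Local v × (cmDatum L 1 (Matrix.of fun i j : Fin 1 => if i.val + j.val + 1 = 1 then (1 : L) else 0)).Local v)) : Set ((cmDatum L 2 (Matrix.of fun i j : Fin 2 => if i.val + j.val + 1 = 2 then (1 : L) else 0)).Local v × (cmDatum L 1 (Matrix.of fun i j : Fin 1 => if i.val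 + j.val + 1 = 1 then (1 : L) else 0)).Local v)) • z) hsum

/-- Parity bits are unique: two `e, e' ≤ 1` characterised by the same proposition agree. [cite: Rogawski1990, §4.9 p. 54] -/
private theorem eq_of_iff_eq_zero_of_le_one_S1r {X : Prop} {e e' : ℕ} (he : e ≤ 1) (he' : e' ≤ 1) (h : e = 0 ↔ X) (h' : e' = 0 ↔ X) : e' = e := by
  rcases Nat.le_one_iff_eq_zero_or_eq_one.1 he with rfl | rfl <;> rcases Nat.le_one_iff_eq_zero_or_eq_one.1 he' with rfl | rfl
  · rfl
  · exact absurd (h'.2 (h.1 rfl)) one_ne_zero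
  · exact absurd (h.2 (h'.1 rfl)) one_ne_zero
  · rfl

-- `L_w`-sized statement: elaboration budget only (no search)
set_option maxHeartbeats 1600000 in
include hw in
/-- **S1-ram, CHOICE-FREE FORM** (for the R5b-PAIR ∕ END assembler: bits and value points named by their CHARACTERISATION ∕ MATRICES).  Same hypotheses as
`integral_conj_eq_smul_signedDepthExpansion_onePlace_ramified` plus `Odd N` (★ B-p12 `odd_of_valuation_sub_eq_of_norm_one`: automatic on the torus); for ANY `e : ℕ → ℕ`
with `e i ≤ 1` and, for odd `i < m`, `e i = 0 ⟺ S̄ᵢ` square, ANY `xm ∈ U` with matrix `u₁·1` and ANY `xs i ∈ U` (odd `i < m`) with matrix `u₁(1 + ϖ^i[[0,η^{e i}],[0,0]])`, the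
signed depth expansion holds with THESE points (even `i < m` carry weight `0` since `N` is odd). [cite: LabesseLanglands1979, §2 Lemma 2.1 pp. 8–9]
[cite: Rogawski1990, §4.9 pp. 54–56, Lemma 4.9.3] [cite: Kottwitz1988, §2] -/
theorem integral_conj_eq_smul_signedDepthExpansion_onePlace_ramified_of_coe_eq
    (he : v.asIdeal.ramificationIdx' w.1.asIdeal ≠ 1) (h2 : Valued.v (2 : w.1.adicCompletion L) = 1)
    (ϖ : (w.1.adicCompletion L)ˣ) (hϖ : Valued.v (ϖ : w.1.adicCompletion L) = WithZero.exp (-1 : ℤ)) (hσϖ : galAdicCompletionMap (L := L) (IsCMField.complexConj L) hw (ϖ : w.1.adicCompletion L) = -(ϖ : w.1.adicCompletion L))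
    (σO : 𝒪[w.1.adicCompletion L] →+* 𝒪[w.1.adicCompletion L]) (hσO' : ∀ x : 𝒪[w.1.adicCompletion L], ((σO x : 𝒪[w.1.adicCompletion L]) : w.1.adicCompletion L) = galAdicCompletionMap (L := L) (IsCMField.complexConj L) hw x)
    (hσσ : ∀ x, σO (σO x) = x) (hres : ∀ x : 𝒪[w.1.adicCompletion L], σO x - x ∈ IsLocalRing.maximalIdeal 𝒪[w.1.adicCompletion L])
    {η : 𝒪[w.1.adicCompletion L]} (hηu : IsUnit η) (hση : σO η = η) (hη : ¬ IsSquare (IsLocalRing.residue 𝒪[w.1.adicCompletion L] η))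
    (K : Subgroup ((cmDatum L 2 (Matrix.of fun i j : Fin 2 => if i.val + j.val + 1 = 2 then (1 : L) else 0)).Local v)) (E₂ : (cmDatum L 2 (Matrix.of fun i j : Fin 2 => if i.val + j.val + 1 = 2 then (1 : L) else 0)).Local v ≃ₜ* ↥(unitaryGroupOfForm (galAdicCompletionMap (L := L) (IsCMField.complexConj L) hw) (placeForm (Matrix.of fun i j : Fin 2 => if i.val + j.val + 1 = 2 then (1 : L) else 0) w.1))) (hK : ∀ g, g ∈ K ↔ E₂ g ∈ (glInt 2 (w.1.adicCompletion L)).subgroupOf (unitaryGroupOfForm (galAdicCompletionMap (L := L) (IsCMField.complexConj L) hw) (placeForm (Matrix.of fun i j : Fin 2 => if i.val + j.val + 1 = 2 then (1 : L) else 0) w.1)))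
    (hKo : IsOpen ((K.prod (⊤ : Subgroup ((cmDatum L 1 (Matrix.of fun i j : Fin 1 => if i.val + j.val + 1 = 1 then (1 : L) else 0)).Local v)) : Subgroup ((cmDatum L 2 (Matrix.of fun i j : Fin 2 => if i.val + j.val + 1 = 2 then (1 : L) else 0)).Local v × (cmDatum L 1 (Matrix.of fun i j : Fin 1 => if i.val + j.val + 1 = 1 then (1 : L) else 0)).Local v)) : Set ((cmDatum L 2 (Matrix.of fun i j : Fin 2 => if i.val + j.val + 1 = 2 then (1 : L) else 0)).Local v × (cmDatum L 1 (Matrix.of fun i j : Fin 1 => if i.val + j.val + 1 = 1 then (1 : L) else 0)).Local v)))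
    (hKν : ν ((K.prod (⊤ : Subgroup ((cmDatum L 1 (Matrix.of fun i j : Fin 1 => if i.val + j.val + 1 = 1 then (1 : L) else 0)).Local v)) : Subgroup ((cmDatum L 2 (Matrix.of fun i j : Fin 2 => if i.val + j.val + 1 = 2 then (1 : L) else 0)).Local v × (cmDatum L 1 (Matrix.of fun i j : Fin 1 => if i.val + j.val + 1 = 1 then (1 : L) else 0)).Local v)) : Set ((cmDatum L 2 (Matrix.of fun i j : Fin 2 => if i.val + j.val + 1 = 2 then (1 : L) else 0)).Local v × (cmDatum L 1 (Matrix.of fun i j : Fin 1 => if i.val + j.val + 1 = 1 then (1 : L) else 0)).Local v)) ≠ ⊤)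
    (x : ((cmDatum L 2 (Matrix.of fun i j : Fin 2 => if i.val + j.val + 1 = 2 then (1 : L) else 0)).Local v × (cmDatum L 1 (Matrix.of fun i j : Fin 1 => if i.val + j.val + 1 = 1 then (1 : L) else 0)).Local v)) {Q : GL (Fin 2) (w.1.adicCompletion L)} {u : Fin 2 → w.1.adicCompletion L}
    (hQ : (((E₂ x.1 : ↥(unitaryGroupOfForm (galAdicCompletionMap (L := L) (IsCMField.complexConj L) hw) (placeForm (Matrix.of fun i j : Fin 2 => if i.val + j.val + 1 = 2 then (1 : L) else 0) w.1))) : GL (Fin 2) (w.1.adicCompletion L)) : Matrix (Fin 2) (Fin 2) (w.1.adicCompletion L)) * (Q : Matrix (Fin 2) (Fin 2) (w.1.adicCompletion L)) = (Q : Matrix (Fin 2) (Fin 2) (w.1.adicCompletion L)) * diagonal u) (hu : Function.Injective u)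
    (hu1 : ∀ i, galAdicCompletionMap (L := L) (IsCMField.complexConj L) hw (u i) * u i = 1) {N : ℕ} (hN : Valued.v (u 0 - u 1) = Valued.v (ϖ : w.1.adicCompletion L) ^ N) (hN1 : Odd N)
    {h : Fin 2 → w.1.adicCompletion L} (hQh : formCongr (galAdicCompletionMap (L := L) (IsCMField.complexConj L) hw) Q (placeForm (Matrix.of fun i j : Fin 2 => if i.val + j.val + 1 = 2 then (1 : L) else 0) w.1) = Matrix.diagonal h) (hh : ∀ i, Valued.v (h i) = 1)
    (hσh : ∀ i, galAdicCompletionMap (L := L) (IsCMField.complexConj L) hw (h i) = h i) (r : 𝒪[w.1.adicCompletion L]) (hr : h 0 * (r : w.1.adicCompletion L) = -h 1) (hsq : IsSquare (IsLocalRing.residue 𝒪[w.1.adicCompletion L] r))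
    {m : ℕ} (hmN : m ≤ N) (Km : Subgroup ↥(unitaryGroupOfForm (galAdicCompletionMap (L := L) (IsCMField.complexConj L) hw) (placeForm (Matrix.of fun i j : Fin 2 => if i.val + j.val + 1 = 2 then (1 : L) else 0) w.1)))
    (hKm : ∀ y : ↥(unitaryGroupOfForm (galAdicCompletionMap (L := L) (IsCMField.complexConj L) hw) (placeForm (Matrix.of fun i j : Fin 2 => if i.val + j.val + 1 = 2 then (1 : L) else 0) w.1)), (∀ r s, (ϖ : w.1.adicCompletion L) ^ (-(m : ℤ)) * ((((y : ↥(unitaryGroupOfForm (galAdicCompletionMap (L := L) (IsCMField.complexConj L) hw) (placeForm (Matrix.of fun i j : Fin 2 => if i.val + j.val + 1 = 2 then (1 : L) else 0) w.1))) : GL (Fin 2) (w.1.adicCompletion L)) : Matrix (Fin 2) (Fin 2) (w.1.adicCompletion L)) - 1) r s ∈ 𝒪[w.1.adicCompletion L]) → y ∈ Km)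
    (φ : ((cmDatum L 2 (Matrix.of fun i j : Fin 2 => if i.val + j.val + 1 = 2 then (1 : L) else 0)).Local v × (cmDatum L 1 (Matrix.of fun i j : Fin 1 => if i.val + j.val + 1 = 1 then (1 : L) else 0)).Local v) → E) (hφs : support φ ⊆ ((K.prod (⊤ : Subgroup ((cmDatum L 1 (Matrix.of fun i j : Fin 1 => if i.val + j.val + 1 = 1 then (1 : L) else 0)).Local v)) : Subgroup ((cmDatum L 2 (Matrix.of fun i j : Fin 2 => if i.val + j.val + 1 = 2 then (1 : L) else 0)).Local v × (cmDatum L 1 (Matrix.of fun i j : Fin 1 => if i.val + j.val + 1 = 1 then (1 : L) else 0)).Local v)) : Set ((cmDatum L 2 (Matrix.of fun i j : Fin 2 => if i.val + j.val + 1 = 2 then (1 : L) else 0)).Local v × (cmDatum L 1 (Matrix.of fun i j : Fin 1 => if i.val + j.val + 1 = 1 then (1 : L) else 0)).Local v)))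
    (hφK : ∀ k ∈ (K.prod (⊤ : Subgroup ((cmDatum L 1 (Matrix.of fun i j : Fin 1 => if i.val + j.val + 1 = 1 then (1 : L) else 0)).Local v)) : Subgroup ((cmDatum L 2 (Matrix.of fun i j : Fin 2 => if i.val + j.val + 1 = 2 then (1 : L) else 0)).Local v × (cmDatum L 1 (Matrix.of fun i j : Fin 1 => if i.val + j.val + 1 = 1 then (1 : L) else 0)).Local v)), ∀ y, φ (k * y * k⁻¹) = φ y)
    (hφm : ∀ x' : ↥(unitaryGroupOfForm (galAdicCompletionMap (L := L) (IsCMField.complexConj L) hw) (placeForm (Matrix.of fun i j : Fin 2 => if i.val + j.val + 1 = 2 then (1 : L) else 0) w.1)), ∀ y ∈ Km, φ (E₂.symm (x' * y), x.2) = φ (E₂.symm x', x.2))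
    (hc : IsCompact {y : ((cmDatum L 2 (Matrix.of fun i j : Fin 2 => if i.val + j.val + 1 = 2 then (1 : L) else 0)).Local v × (cmDatum L 1 (Matrix.of fun i j : Fin 1 => if i.val + j.val + 1 = 1 then (1 : L) else 0)).Local v) | y * x * y⁻¹ ∈ ((K.prod (⊤ : Subgroup ((cmDatum L 1 (Matrix.of fun i j : Fin 1 => if i.val + j.val + 1 = 1 then (1 : L) else 0)).Local v)) : Subgroup ((cmDatum L 2 (Matrix.of fun i j : Fin 2 => if i.val + j.val + 1 = 2 then (1 : L) else 0)).Local v × (cmDatum L 1 (Matrix.of fun i j : Fin 1 => if i.val + j.val + 1 = 1 then (1 : L) else 0)).Local v)) : Set ((cmDatum L 2 (Matrix.of fun i j : Fin 2 => if i.val + j.val + 1 = 2 then (1 : L) else 0)).Local v × (cmDatum L 1 (Matrix.of fun i j : Fin 1 => if i.val + j.val + 1 = 1 then (1 : L) else 0)).Local v))})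
    (e : ℕ → ℕ) (he1 : ∀ i, e i ≤ 1)
    (hbit : ∀ i < m, Odd i → ∀ S : 𝒪[w.1.adicCompletion L], (S : w.1.adicCompletion L) = (-1) ^ ((N + i) / 2 + 1) * u 1 * ((u 0 - u 1) * ((ϖ : w.1.adicCompletion L) ^ N)⁻¹) * h 0 →
      (e i = 0 ↔ IsSquare (IsLocalRing.residue 𝒪[w.1.adicCompletion L] S)))
    (xm : ↥(unitaryGroupOfForm (galAdicCompletionMap (L := L) (IsCMField.complexConj L) hw) (placeForm (Matrix.of fun i j : Fin 2 => if i.val + j.val + 1 = 2 then (1 : L) else 0) w.1))) (hxm : (((xm : ↥(unitaryGroupOfForm (galAdicCompletionMap (L := L) (IsCMField.complexConj L) hw) (placeForm (Matrix.of fun i j : Fin 2 => if i.val + j.val + 1 = 2 then (1 : L) else 0) w.1))) : GL (Fin 2) (w.1.adicCompletion L)) : Matrix (Fin 2) (Fin 2) (w.1.adicCompletion L)) = u 1 • (1 : Matrix (Fin 2) (Fin 2) (w.1.adicCompletion L)))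
    (xs : ℕ → ↥(unitaryGroupOfForm (galAdicCompletionMap (L := L) (IsCMField.complexConj L) hw) (placeForm (Matrix.of fun i j : Fin 2 => if i.val + j.val + 1 = 2 then (1 : L) else 0) w.1)))
    (hxs : ∀ i < m, Odd i → (((xs i : ↥(unitaryGroupOfForm (galAdicCompletionMap (L := L) (IsCMField.complexConj L) hw) (placeForm (Matrix.of fun i j : Fin 2 => if i.val + j.val + 1 = 2 then (1 : L) else 0) w.1))) : GL (Fin 2) (w.1.adicCompletion L)) : Matrix (Fin 2) (Fin 2) (w.1.adicCompletion L)) = u 1 • ((1 : Matrix (Fin 2) (Fin 2) (w.1.adicCompletion L)) + (ϖ : w.1.adicCompletion L) ^ i • !![0, ((η : 𝒪[w.1.adicCompletion L]) : w.1.adicCompletion L) ^ (e i); 0, 0])) :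
    ∫ y, φ (y * x * y⁻¹) ∂ν = ν.real ((K.prod (⊤ : Subgroup ((cmDatum L 1 (Matrix.of fun i j : Fin 1 => if i.val + j.val + 1 = 1 then (1 : L) else 0)).Local v)) : Subgroup ((cmDatum L 2 (Matrix.of fun i j : Fin 2 => if i.val + j.val + 1 = 2 then (1 : L) else 0)).Local v × (cmDatum L 1 (Matrix.of fun i j : Fin 1 => if i.val + j.val + 1 = 1 then (1 : L) else 0)).Local v)) : Set ((cmDatum L 2 (Matrix.of fun i j : Fin 2 => if i.val + j.val + 1 = 2 then (1 : L) else 0)).Local v × (cmDatum L 1 (Matrix.of fun i j : Fin 1 => if i.val + j.val + 1 = 1 then (1 : L) else 0)).Local v)) •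
      ((∑ j ∈ (range (N + 1)).filter (fun j => j % 2 = 0 ∧ j + m ≤ N), (if j = 0 then 1 else 2 * Nat.card (𝓞 ↥(maximalRealSubfield L) ⧸ v.asIdeal) ^ (j / 2))) • φ (E₂.symm xm, x.2) +
        ∑ i ∈ range m, (if i ≤ N ∧ (N - i) % 2 = 0 then (if N - i = 0 then 1 else 2 * Nat.card (𝓞 ↥(maximalRealSubfield L) ⧸ v.asIdeal) ^ ((N - i) / 2)) else 0) • φ (E₂.symm (xs i), x.2)) := by
  obtain ⟨e₀, xm₀, xs₀, he₀, hbit₀, hxm₀, hxs₀, hEQ⟩ := integral_conj_eq_smul_signedDepthExpansion_onePlace_ramified L v w hw ν he h2 ϖ hϖ hσϖ σO hσO' hσσ hres hηu hση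
    hη K E₂ hK hKo hKν x hQ hu hu1 hN hQh hh hσh r hr hsq hmN Km hKm φ hφs hφK hφm hc
  -- the sign data `S i` are INTEGERS (products of units), so both characterisations are comparable
  have hϖ0 : (ϖ : w.1.adicCompletion L) ≠ 0 := ϖ.ne_zero
  have hu1O : u 1 ∈ 𝒪[w.1.adicCompletion L] := (Valuation.mem_integer_iff _ _).2 (valuation_eq_one_of_galAdicCompletionMap_mul_self L v w hw (hu1 1)).le
  have hh0O : h 0 ∈ 𝒪[w.1.adicCompletion L] := (Valuation.mem_integer_iff _ _).2 ((v_eq_one_iff_valuation_eq_one (h 0)).1 (hh 0)).le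
  have hwO : (u 0 - u 1) * ((ϖ : w.1.adicCompletion L) ^ N)⁻¹ ∈ 𝒪[w.1.adicCompletion L] := by
    refine (Valuation.mem_integer_iff _ _).2 (le_of_eq ?_)
    have hN' : valuation (w.1.adicCompletion L) (u 0 - u 1) = valuation (w.1.adicCompletion L) ((ϖ : w.1.adicCompletion L) ^ N) := by rw [← v_eq_iff_valuation_eq, hN, map_pow]
    have hϖN1 : valuation (w.1.adicCompletion L) ((ϖ : w.1.adicCompletion L) ^ N) ≠ 0 := (Valuation.ne_zero_iff _).2 (pow_ne_zero _ hϖ0)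
    rw [map_mul, map_inv₀, hN', mul_inv_cancel₀ hϖN1]
  have hSO : ∀ i : ℕ, (-1 : w.1.adicCompletion L) ^ ((N + i) / 2 + 1) * u 1 * ((u 0 - u 1) * ((ϖ : w.1.adicCompletion L) ^ N)⁻¹) * h 0 ∈ 𝒪[w.1.adicCompletion L] :=
    fun i => mul_mem (mul_mem (mul_mem (pow_mem (neg_mem (one_mem _)) _) hu1O) hwO) hh0O
  have hee : ∀ i < m, Odd i → e i = e₀ i := fun i him hio =>
    eq_of_iff_eq_zero_of_le_one_S1r (he₀ i) (he1 i) (hbit₀ i him hio ⟨_, hSO i⟩ rfl) (hbit i him hio ⟨_, hSO i⟩ rfl)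
  have hxm' : xm = xm₀ := Subtype.ext (Units.ext (hxm.trans hxm₀.symm))
  rw [hEQ, hxm']
  congr 2
  refine Finset.sum_congr rfl fun i hi => ?_
  have him : i < m := Finset.mem_range.1 hi
  by_cases hio : Odd i
  · have hxs' : xs i = xs₀ i := Subtype.ext (Units.ext ((hxs i him hio).trans (by rw [hee i him hio, hxs₀ i hio])))
    rw [hxs']
  · -- even `i`: `N − i` is odd (`N` odd, `i ≤ N`), so the weight vanishes
    have hw0 : ¬ (i ≤ N ∧ (N - i) % 2 = 0) := by
      rintro ⟨hiN, hpar⟩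
      apply hio
      rcases hN1 with ⟨k, hk⟩
      exact ⟨(i - 1) / 2, by omega⟩
    rw [if_neg hw0, zero_smul, zero_smul]

end Expansion

end Literature.NumberTheory.Rogawski1990

end
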